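import Mathlib
import HarnessLib
import Summits.HubbardSuperconductivity.HubbardSuperconductivity.Theorems.KLProgrammeKLRegimeEngineScaleZeroLevelZeroFrame
import Summits.HubbardSuperconductivity.HubbardSuperconductivity.Theorems.KLProgrammeKLRegimeEngineTowerLevReadoutCloseFLinkKlEngSharpUnifRows
import Summits.HubbardSuperconductivity.HubbardSuperconductivity.Theorems.KLProgrammeKLRegimeEngineTowerLevReadoutUVF
import Summits.HubbardSuperconductivity.HubbardSuperconductivity.Theorems.KLProgrammeKLRegimeEngineTowerBlockZeroPackageKlEng

/-!
# Route `KLProgramme` — crux K3 ENGINE (stmt-HubbardSuperconductivity-20437 `KLRegimeEngineV17F2`), stub (b) v2, THE LEVELS PACKAGE (ℓ): «(ℓ)-REKEY-ROWS»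
# LINK 7 — THE ∀j ASSEMBLY WITH THE LEVEL `j = 0` DISCHARGED (cell gate-hubbard-kl, seat gate-hubbard-kl-p3 g22; `kernelNormsLevels_all_klEng_final_rows_closed`
# (link 6, p699409) with its RO-3 group at `(Λ_0, F_0)` replaced by ONE binder `(klEngQ7 P R).IsRaiseOf Qe` and closed by k3c2-p1 g7's
# `levelZero_norms_frame_of_isRaiseOf` (…ScaleZeroLevelZeroFrame))

WHY.  Link 6 still takes, for the level `j = 0`, p3's weighted grid step at `(Λ_0, F_0)` (RO-3's closer `kernelNormsLevels_uvF_of_wgridStep`): Gram `κ0`, `gridLabelWt`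
rows `αw0`, `ρ0`, the door guard, grid overlaps `crw0 ccw0`, five equational names and a `CE` threshold — the last E1-DATA class of the levels clause.  But level
zero is a SCALE-0 statement and the scale-0 rung is frame-generic: `levelZero_norms_frame_of_isRaiseOf P R Q hQ …` gives `KernelNormsLevels L M P Q β U μ K 0` at EVERY
admissible frame `K` (only `FrameOK R U n_β μ K` is read) for EVERY raise `Q` of `klEngQ7 P R` (`isRaiseOf_klEngQ8/Q9/Q9c`, `isRaiseOf_withCR_withCE`), under
`P.WF`, `R.WF2`, `0 < c ≤ klEngC₃6`, `μ ∈ klWindowC`, `0 < U ≤ klEngU₀9`, the β-regime, `klEngL₃ ≤ L`, `klEngM₃ ≤ M` — all already in link 6's prefix.  So the whole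
RO-3 group is replaced by the single structural binder `(klEngQ7 P R).IsRaiseOf Qe` on the numerics package; everything else is byte-identical to link 6.
INPUT CLASSES OF THE LEVELS CLAUSE after this file: NO grid/E1-data row remains; the level-0 datum rows `Nb₀ hcar₀ hlawb₀` at `Λ_1` (a THEOREM under c/U doors:
`exists_levelZeroBaseRows_klEng`, …ScaleOneBaseRows) and `Z^{K_n}_{Λ_1}` (p686893); imports ι / six-leg cells / blocking / `B ≥ B₀` [E1]; doors, smallness rows,
`CE` thresholds, caps, the block-0 kit guard, `Atot₁ ≤ Ab'`/`Qtot₁ ≤ Qb`, and `Qe` a raise of `klEngQ7 P R` [numerics].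

* **`kernelNormsLevels_all_klEng_final_closed (c″)`** ⊢ `∀ j ≤ n, KernelNormsLevels L M P Qe β U μ (klFlowFrameU L M β U μ n) j`.
Bookkeeping composition of landed theorems; every analytic and numerical input is a hypothesis; nothing asserts (ℓ), any stub, K3 or superconductivity.
References: BGM 2006 §2.8 (2.76)–(2.84), (2.93)–(2.98), Lemma 2.5, §3 (3.2)–(3.8) [cite: BenfattoGiulianiMastropietro2006].
-/

noncomputable section

namespace Summit.HubbardSuperconductivity.HubbardSuperconductivity.Theorems.EngineV8

set_option linter.dupNamespace false -- summit = problem name (single-conjunct summit), D-0017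

open Classical
open Real Finset Literature.MathematicalPhysics.QuantumLattice Literature.Probability.LatticeModels GrassmannAlgebra
open Literature.Probability.LatticeModels.BattleFederbush
open Literature.MathematicalPhysics.QuantumLattice.FermiRG
open Summit.HubbardSuperconductivity.HubbardSuperconductivity.Theorems.KLProgrammeLegKernels
open Summit.HubbardSuperconductivity.HubbardSuperconductivity.Theorems.KLRegimeSplit
open Summit.HubbardSuperconductivity.HubbardSuperconductivity.Theorems.KLRegimeWick
open Summit.HubbardSuperconductivity.HubbardSuperconductivity.Theorems.TorusFourierL2
open Summit.HubbardSuperconductivity.HubbardSuperconductivity.Theorems.DispersionFlow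

variable {L M : ℕ} [NeZero L] [NeZero M]

set_option maxHeartbeats 400000 in -- one ~200-binder composition instantiated per level
/-- **STUB (b)'s LEVELS CLAUSE ON THE FLOW FRAME — FINAL ASSEMBLY, BASE DATUM, `Z^{K_n}_{Λ_d}` AND THE LEVEL `0` DISCHARGED** («(ℓ)-REKEY-ROWS» link 7; see the
module docstring): conclusion `∀ j ≤ n, KernelNormsLevels L M P Qe β U μ (klFlowFrameU L M β U μ n) j`. [cite: BenfattoGiulianiMastropietro2006, §2.8 (2.76)-(2.84), (2.93)-(2.98), Lemma 2.5 (2.98), §3 (3.2)-(3.8)] -/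
theorem kernelNormsLevels_all_klEng_final_closed (c'' : ℝ) (hc'' : 0 < c'') :
    ∃ C₁ C₂ C₁' C₂' Cinc Dinc : ℝ, 0 < C₁ ∧ 0 < C₂ ∧ 0 < C₁' ∧ 0 < C₂' ∧ 0 < Cinc ∧ 1 ≤ Dinc ∧
    ∀ R : RenConsts, R.WF2 → ∃ c₃' : ℝ, 0 < c₃' ∧ ∃ U₀' : ℝ, 0 < U₀' ∧
      ∃ Cκ CJ : ℝ, 0 < Cκ ∧ 0 < CJ ∧ ∀ d : ℕ, ∃ Cb : ℝ, 0 < Cb ∧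
      -- block 0's own constants (p3 g22's `kernelNormsLevels_blockZeroF_klEng d c''`): increment constants, thresholds, link triple — all indexed by `d`
      ∃ Cinc₀ Dinc₀ Cinc₁ Dinc₁ c₃'' U₀'' : ℝ, 0 < Cinc₀ ∧ 1 ≤ Dinc₀ ∧ 1 ≤ Cinc₁ ∧ 1 ≤ Dinc₁ ∧ 0 < c₃'' ∧ 0 < U₀'' ∧
      ∃ Cκ₀ Cb₀ CJ₀ : ℝ, 0 < Cκ₀ ∧ 0 < Cb₀ ∧ 0 < CJ₀ ∧
      ∀ (G : GeoConsts) (P : SplitConsts) (Qh : EngConsts) (c : ℝ), P.WF → 0 < c → c ≤ klEngC₃6 P R → c ≤ c₃' → c ≤ c₃'' →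
      ∀ μ ∈ klWindowC, ∀ U : ℝ, 0 < U → U ≤ klEngU₀9 P R c → U ≤ U₀' → U ≤ U₀'' → c'' * U ≤ 1 → ∀ β : ℝ, klBetaMin ≤ β → β ≤ Real.exp (c / U ^ 2) →
      ∀ (L M : ℕ) [NeZero L] [NeZero M], klEngL₃ β U ≤ L → klEngM₃ β U L ≤ M →
      ∀ n : ℕ, 1 ≤ n → n ≤ nScales β + 1 → IsKLRegime U c (-(n : ℤ)) →
        HistP klPredsV17F2 L M G P Qh R β U μ 0 n → FrameOK R U (nScales β) μ (klFlowFrameU L M β U μ n) →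
        (∀ m, 1 ≤ m → m < n → FlowPieceOscAt L M c'' β U μ m) →
      2 ≤ d → ∀ D : ℕ, 3 ≤ D →
      ∀ (cc : ℝ) (n' : ℕ), IsKLRegime U cc (-(n' : ℤ)) → n ≤ n' →
      ∀ (B : ℝ), 1 ≤ B →
      -- the main tower's base amplitudes `Ab Qb` (must dominate block 0's base read-out constants `Atot₁ d`, `Qtot₁`, see below) and the imports `ι₂ X`;
      -- the base DATUM itself (`𝒱_d[K_n]` at `F_{d−1}`) and `Z^{K_n}_{Λ_d}` are DISCHARGED from block 0 inside (p3 g22 «(ℓ)-BLOCK0-PACKAGE»)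
      ∀ (Ab Qb ι₂ X : ℝ), 0 < Ab → 0 ≤ Qb → 0 ≤ ι₂ → 0 ≤ X →
      ∀ (Ab' ι₂' X' : ℝ), Ab' = Ab / B ^ 2 → ι₂' = ι₂ / B → X' = X / B ^ 2 →
      -- the floor LINK data DISCHARGED on the flow frame (`linkDataPartialF_klEng'`): the four k-free constants pinned, the degree cap kept
      ∀ (κb αb crb ccb : ℝ), κb = Real.sqrt (2 * Cκ * klE0) → αb = Cb * ((M : ℝ) / β) * (4 : ℝ) ^ d / klE0 →
        crb = 81 * CJ * M / β → ccb = 162 * CJ * M / β →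
      (∀ k, 1 ≤ k → d * k ≤ n → Fintype.card (SpaceTimeIdx L M × SectorLeg (sectorCount (d * k - 1))) / 2 ≤ D) →
      -- the law's six names PINNED by the link (equational binders), and the import `ι₁`
      ∀ (W Z σ Φ ψ τ ι₁ : ℝ), W = 64 * (27 : ℝ) ^ 4 * exp 2 * crb / ccb → Z = exp 4 * ccb ^ 2 * imagTimeWeight β M ^ 2 / 8 →
        σ = κb ^ 2 / (exp 4 * ccb ^ 2) → Φ = 9 * αb * ccb / ((27 : ℝ) ^ 5 * exp 1 * κb ^ 2 * crb) → ψ = exp 4 * ccb ^ 2 / κb ^ 2 →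
        τ = exp 2 * κb ^ 2 / ccb ^ 2 → 0 ≤ ι₁ →
      ∀ (ρk Q' Q κA Yb Y A A' ι₃ : ℝ), ρk = max 4 (2 * τ * ψ) → Q' = Z * Qb + 1 → Q = ρk * Q' →
        κA = W * ((27 : ℝ) ^ 5 * (C₁ / C₂) * (8 : ℝ) ^ (d - 1)) →
        Yb = ι₂ / (2 * Q') + W * Z ^ 3 * X / (4 * Q' ^ 2) + (W * (27 : ℝ) ^ 5 * Ab + κA * Ab) * Q' / 2 →
        Y = ι₂' / (2 * Q') + W * Z ^ 3 * X' / (4 * Q' ^ 2) + (W * (27 : ℝ) ^ 5 * Ab' + κA * Ab') * Q' / 2 →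
        A = 2 * Y * (1 - ((2 : ℝ) ^ d)⁻¹) / (κA * Q') →
        A' = (W * (27 : ℝ) ^ 5 * Ab' + κA * Ab') + 2 * Y / Q' → ι₃ = W * Z ^ 3 * X' + A' * Q' ^ 3 →
      max 1 Z * C₂ ^ 2 * max 4 (2 * τ * ψ) ≤ (2 : ℝ) ^ (d - 1) →
      max 1 (max (8 * Φ * τ * Yb) (128 * exp 1 * ψ ^ 3 * τ ^ 4 * Φ * κA * Yb / ((1 - ((2 : ℝ) ^ d)⁻¹) * ρk ^ 3))) ≤ B →
      -- E1's imports and six-leg cells, block by block, each at the block's own base level `λ_{dk} = B·ε_{dk}` (monotone in the level)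
      (∀ k, 1 ≤ k → d * k ≤ n → W * Z ^ 1 * klTowerMuLevF L M β U μ (klFlowFrameU L M β U μ n) d k 1 ≤ ι₁ * (B * epsCoupling P U (d * k))) →
      (∀ k, 1 ≤ k → d * k ≤ n → W * Z ^ 2 * klTowerMuLevF L M β U μ (klFlowFrameU L M β U μ n) d k 2 ≤ ι₂' * (B * epsCoupling P U (d * k))) →
      (∀ k, 2 ≤ k → d * k ≤ n → klTowerMuLevAtF L M β U μ (klFlowFrameU L M β U μ n) d 0 k 3 ≤ X' * (B * epsCoupling P U (d * k)) ^ 2) →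
      U ≤ min 1 (min (1 / (8 * σ * Q' + 1)) (min (1 / (2 * exp 1 * τ * Q' + 1)) (min (1 / (4 * Φ * τ * ι₁ + 1))
        (min (1 / (2 * (Φ * (exp 1 * τ * ι₁ + (exp 1 * τ) ^ 2 * ι₂' + (exp 1 * τ) ^ 3 * ι₃ + A' * (exp 1 * τ * Q') ^ 2 / 2)) + 1))
          (min (A * Q ^ 3 / (16 * σ * Q' * A' * (4 * Q') ^ 3 + A * Q ^ 3))
            (A * Q ^ 3 / (16 * exp 1 * ψ * (2 * τ * ψ * Q') ^ 2 * Φ * τ ^ 2 * ι₁ ^ 2 + A * Q ^ 3))))))) / (2 * B * P.Klam + 1) →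
      cc ≤ min 1 (min (1 / (8 * σ * Q' + 1)) (min (1 / (2 * exp 1 * τ * Q' + 1)) (min (1 / (4 * Φ * τ * ι₁ + 1))
        (min (1 / (2 * (Φ * (exp 1 * τ * ι₁ + (exp 1 * τ) ^ 2 * ι₂' + (exp 1 * τ) ^ 3 * ι₃ + A' * (exp 1 * τ * Q') ^ 2 / 2)) + 1))
          (min (A * Q ^ 3 / (16 * σ * Q' * A' * (4 * Q') ^ 3 + A * Q ^ 3))
            (A * Q ^ 3 / (16 * exp 1 * ψ * (2 * τ * ψ * Q') ^ 2 * Φ * τ ^ 2 * ι₁ ^ 2 + A * Q ^ 3))))))) * Real.log 4 / (2 * B * P.Klam + 1) →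
      -- the read-out constants (equational binders; `Atot` level by level through `λ_j = B·ε_j`), the public constant's threshold at every level `d ≤ j ≤ n`,
      -- the degree cap, the six-leg cells at every level `d ≤ j ≤ n`
      ∀ (Aro Qro Qtot : ℝ) (Atot : ℕ → ℝ), Aro = (27 : ℝ) ^ 5 * (C₁' / C₂') * (Ab' + (8 : ℝ) ^ (d - 1) * (A / (1 - ((2 : ℝ) ^ d)⁻¹))) →
        Qro = C₂' ^ 2 * max Qb (((2 : ℝ) ^ (d - 1))⁻¹ * max Q Qb) → Qtot = Dinc * max 1 (max Qro (max (4 * Q') (2 * τ * ψ * Q'))) →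
        (∀ j : ℕ, Atot j = Aro + Cinc * (A' * (4 * σ * (B * epsCoupling P U j) * Q' / (1 - 4 * σ * (B * epsCoupling P U j) * Q')) +
          exp 1 * (τ * (ι₁ * (B * epsCoupling P U j) + ι₂' / (2 * Q') + ι₃ / (4 * Q' ^ 2) + A' * Q' / 4)) *
            (Φ * (τ * (ι₁ * (B * epsCoupling P U j) + ι₂' / (2 * Q') + ι₃ / (4 * Q' ^ 2) + A' * Q' / 4)) /
              (1 - Φ * (τ * (ι₁ * (B * epsCoupling P U j) + ι₂' / (2 * Q') + ι₃ / (4 * Q' ^ 2) + A' * Q' / 4)))) / (2 * τ * Q'))) →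
      ∀ Qe : EngConsts, (∀ j : ℕ, d ≤ j → j ≤ n → Qtot * imagTimeWeight β M ^ 2 * B * max 1 (Atot j / imagTimeWeight β M) ≤ Qe.CE) →
      Fintype.card (HubbardFieldIdx L M) ≤ 2 * D + 1 →
      (∀ j : ℕ, 1 ≤ j → j ≤ n → ∀ Ωe : Fin (2 * 3) → Option (SectorLeg (sectorCount j)), levelCount Ωe = 1 →
        klAnisoLegKernelNormAt L M β U μ (klFlowFrameU L M β U μ n) klE0 j (2 * 3) Ωe ≤ Qe.CE ^ 3 * (epsCoupling P U j) ^ 2 * (2 : ℝ) ^ ((4 : ℤ) * j)) →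
      -- THE LEVELS `1 ≤ j < d` (block 0, p3 g22's `kernelNormsLevels_blockZeroF_klEng`): the partition function at `Λ_1`, the level-0 datum of `𝒱_1[K_n]`
      -- at `F_0` with its unit law AT `λ_1 = B·ε_1` (moved to the level inside), the kit cap at `sectorCount 0`, block 0's own pins, the Chernoff data and
      -- imports of `W₀·Z₀^m·klTowerMuLevF … 1 1 m` AT `λ_1`, the five smallness rows and the CE threshold at every level `1 ≤ j < d`
      hubbardEffPartitionFnCT L M β U μ 0 (klFlowFrameU L M β U μ n) (klScale klE0 1) ≠ 0 →
      ∀ (Ab₀ Qb₀ : ℝ), 0 ≤ Ab₀ → 0 ≤ Qb₀ →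
      ∀ Nb₀ : Fin 5 → ℕ → ℝ, (∀ t p, 0 ≤ Nb₀ t p) →
        (∀ (t : Fin 5) (p : ℕ) (Ωe' : Fin (2 * p) → Option (SectorLeg (sectorCount 0))), levelCount Ωe' = (t : ℕ) + 1 →
          klLevNormOf L M β μ (klFlowFrameU L M β U μ n) 0 (2 * p) (klTowerInput L M β U μ (klFlowFrameU L M β U μ n) 1 1) Ωe' ≤ Nb₀ t p) →
        (∀ (t : Fin 5) (p : ℕ), 3 ≤ p → Nb₀ t p / klLevUnitF β M t p 0 ≤ Ab₀ * (B * epsCoupling P U 1) ^ (p - 1) * Qb₀ ^ p) →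
      Fintype.card (SpaceTimeIdx L M × SectorLeg (sectorCount 0)) / 2 ≤ D →
      ∀ (κb₀ αb₀ crb₀ ccb₀ : ℝ), κb₀ = Real.sqrt (2 * Cκ₀ * klE0) → αb₀ = Cb₀ * ((M : ℝ) / β) * (4 : ℝ) ^ d / klE0 →
        crb₀ = 81 * CJ₀ * M / β → ccb₀ = 162 * CJ₀ * M / β →
      ∀ (W₀ Z₀ σ₀ Φ₀ ψ₀ τ₀ : ℝ), W₀ = 64 * (27 : ℝ) ^ 4 * exp 2 * crb₀ / ccb₀ → Z₀ = exp 4 * ccb₀ ^ 2 * imagTimeWeight β M ^ 2 / 8 →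
        σ₀ = κb₀ ^ 2 / (exp 4 * ccb₀ ^ 2) → Φ₀ = 9 * αb₀ * ccb₀ / ((27 : ℝ) ^ 5 * exp 1 * κb₀ ^ 2 * crb₀) → ψ₀ = exp 4 * ccb₀ ^ 2 / κb₀ ^ 2 →
        τ₀ = exp 2 * κb₀ ^ 2 / ccb₀ ^ 2 →
      ∀ (A'₀ Q'₀ ι₁₀ ι₂₀ ι₃₀ : ℝ), 0 ≤ A'₀ → 0 < Q'₀ →
      (∀ m, 4 ≤ m → m ≤ D → W₀ * Z₀ ^ m * klTowerMuLevF L M β U μ (klFlowFrameU L M β U μ n) 1 1 m ≤ A'₀ * (B * epsCoupling P U 1) ^ (m - 1) * Q'₀ ^ m) →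
      W₀ * Z₀ ^ 3 * klTowerMuLevF L M β U μ (klFlowFrameU L M β U μ n) 1 1 3 ≤ ι₃₀ * (B * epsCoupling P U 1) ^ 2 →
      W₀ * Z₀ ^ 1 * klTowerMuLevF L M β U μ (klFlowFrameU L M β U μ n) 1 1 1 ≤ ι₁₀ * (B * epsCoupling P U 1) →
      W₀ * Z₀ ^ 2 * klTowerMuLevF L M β U μ (klFlowFrameU L M β U μ n) 1 1 2 ≤ ι₂₀ * (B * epsCoupling P U 1) →
      (∀ j : ℕ, 1 ≤ j → j ≤ d → j ≤ n →
        4 * σ₀ * (B * epsCoupling P U j) * Q'₀ < 1 ∧ 2 * (B * epsCoupling P U j) * τ₀ * Q'₀ ≤ 1 ∧ exp 1 * τ₀ * (B * epsCoupling P U j) * Q'₀ < 1 ∧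
        Φ₀ * (τ₀ * (ι₁₀ * (B * epsCoupling P U j) + ι₂₀ / (2 * Q'₀) + ι₃₀ / (4 * Q'₀ ^ 2) + A'₀ * Q'₀ / 4)) < 1 ∧
        Φ₀ * (exp 1 * τ₀ * (ι₁₀ * (B * epsCoupling P U j)) + (exp 1 * τ₀) ^ 2 * (ι₂₀ * (B * epsCoupling P U j)) +
            (exp 1 * τ₀) ^ 3 * (ι₃₀ * (B * epsCoupling P U j) ^ 2) +
          A'₀ * (exp 1 * τ₀ * Q'₀) * ((exp 1 * τ₀ * (B * epsCoupling P U j) * Q'₀) ^ 3 / (1 - exp 1 * τ₀ * (B * epsCoupling P U j) * Q'₀))) < 1) →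
      ∀ (Aro₀ Qro₀ Qtot₀ : ℝ) (Atot₀ : ℕ → ℝ), Aro₀ = Cinc₀ * Ab₀ → Qro₀ = Dinc₀ * Qb₀ → Qtot₀ = Dinc₀ * max 1 (max Qro₀ (max (4 * Q'₀) (2 * τ₀ * ψ₀ * Q'₀))) →
        (∀ j : ℕ, Atot₀ j = Aro₀ + Cinc₀ * (A'₀ * (4 * σ₀ * (B * epsCoupling P U j) * Q'₀ / (1 - 4 * σ₀ * (B * epsCoupling P U j) * Q'₀)) +
          exp 1 * (τ₀ * (ι₁₀ * (B * epsCoupling P U j) + ι₂₀ / (2 * Q'₀) + ι₃₀ / (4 * Q'₀ ^ 2) + A'₀ * Q'₀ / 4)) *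
            (Φ₀ * (τ₀ * (ι₁₀ * (B * epsCoupling P U j) + ι₂₀ / (2 * Q'₀) + ι₃₀ / (4 * Q'₀ ^ 2) + A'₀ * Q'₀ / 4)) /
              (1 - Φ₀ * (τ₀ * (ι₁₀ * (B * epsCoupling P U j) + ι₂₀ / (2 * Q'₀) + ι₃₀ / (4 * Q'₀ ^ 2) + A'₀ * Q'₀ / 4)))) / (2 * τ₀ * Q'₀))) →
      (∀ j : ℕ, 1 ≤ j → j < d → j ≤ n → Qtot₀ * imagTimeWeight β M ^ 2 * B * max 1 (Atot₀ j / imagTimeWeight β M) ≤ Qe.CE) →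
      -- block 0's BASE read-out constants at `λ_d` (`baseLawF_blockZero_sharp`'s, `Cinc₁ Dinc₁ ≥ 1`), their domination by the main tower's `Ab' Qb`,
      -- and the block-`0` kit guard (serves the born step of every level `j ≤ d` AND the partition function at `Λ_d`)
      ∀ (Aro₁ Qro₁ Qtot₁ Atot₁ : ℝ), Aro₁ = Cinc₁ * Ab₀ → Qro₁ = Dinc₁ * Qb₀ → Qtot₁ = Dinc₁ * max 1 (max Qro₁ (max (4 * Q'₀) (2 * τ₀ * ψ₀ * Q'₀))) →
        Atot₁ = Aro₁ + Cinc₁ * (A'₀ * (4 * σ₀ * (B * epsCoupling P U d) * Q'₀ / (1 - 4 * σ₀ * (B * epsCoupling P U d) * Q'₀)) +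
          exp 1 * (τ₀ * (ι₁₀ * (B * epsCoupling P U d) + ι₂₀ / (2 * Q'₀) + ι₃₀ / (4 * Q'₀ ^ 2) + A'₀ * Q'₀ / 4)) *
            (Φ₀ * (τ₀ * (ι₁₀ * (B * epsCoupling P U d) + ι₂₀ / (2 * Q'₀) + ι₃₀ / (4 * Q'₀ ^ 2) + A'₀ * Q'₀ / 4)) /
              (1 - Φ₀ * (τ₀ * (ι₁₀ * (B * epsCoupling P U d) + ι₂₀ / (2 * Q'₀) + ι₃₀ / (4 * Q'₀ ^ 2) + A'₀ * Q'₀ / 4)))) / (2 * τ₀ * Q'₀)) →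
      Atot₁ ≤ Ab' → Qtot₁ ≤ Qb →
      Φ₀ * towerV D τ₀ (fun m => W₀ * Z₀ ^ m * klTowerMuLevF L M β U μ (klFlowFrameU L M β U μ n) 1 1 m) < 1 →
      -- THE LEVEL `j = 0`: the numerics package is a raise of `klEngQ7 P R` (level zero is then k3c2-p1's `levelZero_norms_frame_of_isRaiseOf`)
      (klEngQ7 P R).IsRaiseOf Qe →
      ∀ j : ℕ, j ≤ n → KernelNormsLevels L M P Qe β U μ (klFlowFrameU L M β U μ n) j := by
  obtain ⟨C₁, C₂, C₁', C₂', Cinc, Dinc, hC₁, hC₂, hC₁', hC₂', hCinc, hDinc, h⟩ := kernelNormsLevels_readoutF_klEng_sharp_unif_rows c'' hc''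
  refine ⟨C₁, C₂, C₁', C₂', Cinc, Dinc, hC₁, hC₂, hC₁', hC₂', hCinc, hDinc, fun R hR2 => ?_⟩
  obtain ⟨c₃, hc₃, U₀, hU₀, Cκ, CJ, hCκ, hCJ, hd⟩ := h R hR2
  refine ⟨c₃, hc₃, U₀, hU₀, Cκ, CJ, hCκ, hCJ, fun d => ?_⟩
  obtain ⟨Cb, hCb, h'⟩ := hd d
  obtain ⟨Cinc₀, Dinc₀, Cinc₁, Dinc₁, hCinc₀, hDinc₀, hCinc₁, hDinc₁, h5⟩ := blockZeroPackage_klEng d c'' hc''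
  obtain ⟨c₃'', hc₃'', U₀'', hU₀'', Cκ₀, Cb₀, CJ₀, hCκ₀, hCb₀, hCJ₀, h5'⟩ := h5 R hR2
  refine ⟨Cb, hCb, Cinc₀, Dinc₀, Cinc₁, Dinc₁, c₃'', U₀'', hCinc₀, hDinc₀, hCinc₁, hDinc₁, hc₃'', hU₀'', Cκ₀, Cb₀, CJ₀, hCκ₀, hCb₀, hCJ₀, ?_⟩
  intro G P Qh c hP hc hc6 hc₃' hc₃'' μ hμ U hU hU9 hU₀' hU₀'' hcU β hβmin hβc L M _ _ hL3 hM3 n hn1 hnN hreg hhist hfr hosc hd D hD cc n' hreg' hnn' B hB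
    Ab Qb ι₂ X hAb hQb hι₂ hX Ab' ι₂' X' hAb' hι₂' hX'
    κb αb crb ccb hκb hαb hcrb hccb hDall W Z σ Φ ψ τ ι₁ hW hZ hσ hΦ hψ hτ hι₁ ρk Q' Q κA Yb Y A A' ι₃ hρk hQ' hQ hκA hYb hY hA hA' hι₃ hblock hBle
    himp₁ himp₂ hcell hUdoor hcdoor Aro Qro Qtot Atot hAro hQro hQtot hAtot Qe hCE hcard hsix
    hZ1 Ab₀ Qb₀ hAb₀ hQb₀ Nb₀ hNb₀0 hcar₀ hlawb₀ hD0 κb₀ αb₀ crb₀ ccb₀ hκb₀ hαb₀ hcrb₀ hccb₀ W₀ Z₀ σ₀ Φ₀ ψ₀ τ₀ hW₀ hZ₀ hσ₀ hΦ₀ hψ₀ hτ₀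
    A'₀ Q'₀ ι₁₀ ι₂₀ ι₃₀ hA'₀ hQ'₀ hprof₀ hprof3₀ himp₁₀ himp₂₀ hsmall₀ Aro₀ Qro₀ Qtot₀ Atot₀ hAro₀ hQro₀ hQtot₀ hAtot₀ hCE₀
    Aro₁ Qro₁ Qtot₁ Atot₁ hAro₁ hQro₁ hQtot₁ hAtot₁ hAtle hQtle hguard₀
    hQe j hj
  have hβ : 0 < β := KLRegimeSplit.pos_of_klBetaMin_le hβmin
  by_cases hjd : j < d
  · rcases Nat.eq_zero_or_pos j with rfl | hj1
    · -- the level `j = 0`: RO-3's closer at `(Λ_0, F_0)`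
      exact (levelZero_norms_frame_of_isRaiseOf P R Qe hQe c hP hR2 hc hc6 μ hμ U hU hU9 β hβmin hβc (klFlowFrameU L M β U μ n) hfr L M
        hL3 hM3).2.1
    · -- the levels `1 ≤ j < d`: block 0's closer (p3 g22), its rows moved from `λ_1` to `λ_j`
      have hK1 : 1 ≤ P.Klam := hP.1
      have hKl : 0 ≤ P.Klam := le_trans zero_le_one hK1
      have hB0 : 0 < B := lt_of_lt_of_le one_pos hB
      have hε1 : 0 < epsCoupling P U 1 := by
        unfold epsCoupling
        have : 0 < |U| + U ^ 2 * ((1 : ℕ) : ℝ) := by positivity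
        positivity
      have hl1 : 0 < B * epsCoupling P U 1 := mul_pos hB0 hε1
      have hεmono1 : epsCoupling P U 1 ≤ epsCoupling P U j := by
        unfold epsCoupling
        exact mul_le_mul_of_nonneg_left ((add_le_add_iff_left |U|).2 (mul_le_mul_of_nonneg_left (Nat.cast_le.2 hj1) (sq_nonneg U))) hKl
      have hlle : B * epsCoupling P U 1 ≤ B * epsCoupling P U j := mul_le_mul_of_nonneg_left hεmono1 hB0.le
      have hM0 : (0 : ℝ) < M := Nat.cast_pos.2 (Nat.pos_of_ne_zero (NeZero.ne M))
      have he0 : (0 : ℝ) < klE0 := by norm_num [klE0]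
      have hκb₀0 : 0 < κb₀ := by rw [hκb₀]; exact Real.sqrt_pos.2 (by positivity)
      have hcrb₀0 : 0 < crb₀ := by rw [hcrb₀]; positivity
      have hccb₀0 : 0 < ccb₀ := by rw [hccb₀]; positivity
      have hW₀0 : 0 < W₀ := by rw [hW₀]; positivity
      have hZ₀0 : 0 < Z₀ := by
        have hεx : 0 < imagTimeWeight β M := by unfold imagTimeWeight; positivity
        rw [hZ₀]; positivity
      have hμ0 : ∀ m, 0 ≤ W₀ * Z₀ ^ m * klTowerMuLevF L M β U μ (klFlowFrameU L M β U μ n) 1 1 m := fun m =>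
        mul_nonneg (by positivity) (klTowerMuLevF_nonneg (L := L) (M := M) hβ U μ _ 1 1 m)
      -- the signs of the imports from their rows at `λ_1`
      have hι₁0 : 0 ≤ ι₁₀ := by
        have h1 : 0 ≤ ι₁₀ * (B * epsCoupling P U 1) := (hμ0 1).trans himp₁₀
        rw [mul_comm] at h1
        exact nonneg_of_mul_nonneg_right h1 hl1
      have hι₂0 : 0 ≤ ι₂₀ := by
        have h1 : 0 ≤ ι₂₀ * (B * epsCoupling P U 1) := (hμ0 2).trans himp₂₀
        rw [mul_comm] at h1
        exact nonneg_of_mul_nonneg_right h1 hl1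
      have hι₃0 : 0 ≤ ι₃₀ := by
        have h1 : 0 ≤ ι₃₀ * (B * epsCoupling P U 1) ^ 2 := (hμ0 3).trans hprof3₀
        rw [mul_comm] at h1
        exact nonneg_of_mul_nonneg_right h1 (by positivity)
      obtain ⟨hx₁, hx₂, hx₃, hy, hθ'⟩ := hsmall₀ j hj1 hjd.le hj
      exact (h5' G P Qh c hP hc hc6 hc₃'' μ hμ U hU hU9 hU₀'' hcU β hβmin hβc L M hL3 hM3 n hn1 hnN hreg hhist hfr hosc j D hj1 hjd.le hj hD hZ1
        B Ab₀ Qb₀ hB hAb₀ hQb₀ Nb₀ hNb₀0 hcar₀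
        (fun t p hp => (hlawb₀ t p hp).trans
          (mul_le_mul_of_nonneg_right (mul_le_mul_of_nonneg_left (pow_le_pow_left₀ hl1.le hlle _) hAb₀) (pow_nonneg hQb₀ _)))
        hD0 κb₀ αb₀ crb₀ ccb₀ hκb₀ hαb₀ hcrb₀ hccb₀ W₀ Z₀ σ₀ Φ₀ ψ₀ τ₀ hW₀ hZ₀ hσ₀ hΦ₀ hψ₀ hτ₀ A'₀ Q'₀ ι₁₀ ι₂₀ ι₃₀ hA'₀ hQ'₀
        (fun m hm hmD => (hprof₀ m hm hmD).trans
          (mul_le_mul_of_nonneg_right (mul_le_mul_of_nonneg_left (pow_le_pow_left₀ hl1.le hlle _) hA'₀) (pow_nonneg hQ'₀.le _)))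
        (hprof3₀.trans (mul_le_mul_of_nonneg_left (pow_le_pow_left₀ hl1.le hlle 2) hι₃0))
        (himp₁₀.trans (mul_le_mul_of_nonneg_left hlle hι₁0))
        (himp₂₀.trans (mul_le_mul_of_nonneg_left hlle hι₂0))
        hx₁ hx₂ hx₃ hy hθ' hguard₀).2.2 Aro₀ Qro₀ Qtot₀ (Atot₀ j) hAro₀ hQro₀ hQtot₀ (hAtot₀ j) Qe (hCE₀ j hj1 hjd hj) hcard (hsix j hj1 hj)
  · -- block `Kb = j / d ≥ 1`: closer‴ on the flow frame, the block rows moved from `λ_{dk}` to `λ_j`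
    have hd0 : 0 < d := by omega
    have hdj : d ≤ j := not_lt.1 hjd
    set Kb : ℕ := j / d with hKbdef
    have hKb1 : 1 ≤ Kb := Nat.div_pos hdj hd0
    have hKbj : d * Kb ≤ j := Nat.mul_div_le j d
    have hjK : j ≤ d * (Kb + 1) := (Nat.lt_mul_div_succ j hd0).le
    have hKbn : d * Kb ≤ n := hKbj.trans hj
    have hjN : j ≤ nScales β + 1 := hj.trans hnN
    have hjn' : j ≤ n' := hj.trans hnn'
    have hKl : 0 ≤ P.Klam := le_trans zero_le_one hP.1
    have hB0 : 0 ≤ B := zero_le_one.trans hB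
    have hε0 : ∀ i, 0 ≤ epsCoupling P U i := fun i => by unfold epsCoupling; positivity
    have hεmono : ∀ i, i ≤ j → epsCoupling P U i ≤ epsCoupling P U j := fun i hi => by
      unfold epsCoupling
      exact mul_le_mul_of_nonneg_left ((add_le_add_iff_left |U|).2 (mul_le_mul_of_nonneg_left (Nat.cast_le.2 hi) (sq_nonneg U))) hKl
    have hι₂'0 : 0 ≤ ι₂' := by rw [hι₂']; exact div_nonneg hι₂ hB0
    have hX'0 : 0 ≤ X' := by rw [hX']; positivity
    have hAb'0 : 0 ≤ Ab' := by rw [hAb']; positivity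
    -- the base datum of the tower and `Z^{K_n}_{Λ_d}` from block 0 (ONE package, shared pins), its level-0 rows lifted from `λ_1` to `λ_d`
    have hd1 : 1 ≤ d := by omega
    have hdn : d ≤ n := hdj.trans hj
    have hB0' : 0 < B := lt_of_lt_of_le one_pos hB
    have hK1 : 1 ≤ P.Klam := hP.1
    have hε1 : 0 < epsCoupling P U 1 := by
      unfold epsCoupling
      have : 0 < |U| + U ^ 2 * ((1 : ℕ) : ℝ) := by positivity
      positivity
    have hl1 : 0 < B * epsCoupling P U 1 := mul_pos hB0' hε1
    have hεmono1d : epsCoupling P U 1 ≤ epsCoupling P U d := by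
      unfold epsCoupling
      exact mul_le_mul_of_nonneg_left ((add_le_add_iff_left |U|).2 (mul_le_mul_of_nonneg_left (Nat.cast_le.2 hd1) (sq_nonneg U))) hKl
    have hlled : B * epsCoupling P U 1 ≤ B * epsCoupling P U d := mul_le_mul_of_nonneg_left hεmono1d hB0
    have hM0 : (0 : ℝ) < M := Nat.cast_pos.2 (Nat.pos_of_ne_zero (NeZero.ne M))
    have he0 : (0 : ℝ) < klE0 := by norm_num [klE0]
    have hcrb₀0 : 0 < crb₀ := by rw [hcrb₀]; positivity
    have hccb₀0 : 0 < ccb₀ := by rw [hccb₀]; positivity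
    have hW₀0 : 0 < W₀ := by rw [hW₀]; positivity
    have hZ₀0 : 0 < Z₀ := by
      have hεx : 0 < imagTimeWeight β M := by unfold imagTimeWeight; positivity
      rw [hZ₀]; positivity
    have hμ00 : ∀ m, 0 ≤ W₀ * Z₀ ^ m * klTowerMuLevF L M β U μ (klFlowFrameU L M β U μ n) 1 1 m := fun m =>
      mul_nonneg (by positivity) (klTowerMuLevF_nonneg (L := L) (M := M) hβ U μ _ 1 1 m)
    have hι₁00 : 0 ≤ ι₁₀ := by
      have h1 : 0 ≤ ι₁₀ * (B * epsCoupling P U 1) := (hμ00 1).trans himp₁₀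
      rw [mul_comm] at h1
      exact nonneg_of_mul_nonneg_right h1 hl1
    have hι₂00 : 0 ≤ ι₂₀ := by
      have h1 : 0 ≤ ι₂₀ * (B * epsCoupling P U 1) := (hμ00 2).trans himp₂₀
      rw [mul_comm] at h1
      exact nonneg_of_mul_nonneg_right h1 hl1
    have hι₃00 : 0 ≤ ι₃₀ := by
      have h1 : 0 ≤ ι₃₀ * (B * epsCoupling P U 1) ^ 2 := (hμ00 3).trans hprof3₀
      rw [mul_comm] at h1
      exact nonneg_of_mul_nonneg_right h1 (by positivity)
    obtain ⟨hx₁d, hx₂d, hx₃d, hyd, hθd⟩ := hsmall₀ d hd1 le_rfl hdn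
    obtain ⟨hZd, hbase, -⟩ := h5' G P Qh c hP hc hc6 hc₃'' μ hμ U hU hU9 hU₀'' hcU β hβmin hβc L M hL3 hM3 n hn1 hnN hreg hhist hfr hosc d D hd1 le_rfl hdn hD hZ1
      B Ab₀ Qb₀ hB hAb₀ hQb₀ Nb₀ hNb₀0 hcar₀
      (fun t p hp => (hlawb₀ t p hp).trans
        (mul_le_mul_of_nonneg_right (mul_le_mul_of_nonneg_left (pow_le_pow_left₀ hl1.le hlled _) hAb₀) (pow_nonneg hQb₀ _)))
      hD0 κb₀ αb₀ crb₀ ccb₀ hκb₀ hαb₀ hcrb₀ hccb₀ W₀ Z₀ σ₀ Φ₀ ψ₀ τ₀ hW₀ hZ₀ hσ₀ hΦ₀ hψ₀ hτ₀ A'₀ Q'₀ ι₁₀ ι₂₀ ι₃₀ hA'₀ hQ'₀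
      (fun m hm hmD => (hprof₀ m hm hmD).trans
        (mul_le_mul_of_nonneg_right (mul_le_mul_of_nonneg_left (pow_le_pow_left₀ hl1.le hlled _) hA'₀) (pow_nonneg hQ'₀.le _)))
      (hprof3₀.trans (mul_le_mul_of_nonneg_left (pow_le_pow_left₀ hl1.le hlled 2) hι₃00))
      (himp₁₀.trans (mul_le_mul_of_nonneg_left hlled hι₁00))
      (himp₂₀.trans (mul_le_mul_of_nonneg_left hlled hι₂00))
      hx₁d hx₂d hx₃d hyd hθd hguard₀
    have hlawb₁ := hbase hd hcard Aro₁ Qro₁ Qtot₁ Atot₁ hAro₁ hQro₁ hQtot₁ hAtot₁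
    have hQtot₁0 : 0 ≤ Qtot₁ := by rw [hQtot₁]; exact mul_nonneg (zero_le_one.trans hDinc₁) (zero_le_one.trans (le_max_left _ _))
    obtain ⟨hNb0d, hcard'⟩ := klTowerMeasLev_one_baseRows (L := L) (M := M) hβ.le U μ (klFlowFrameU L M β U μ n) d
    have hlawbd : ∀ (t : Fin 5) (p : ℕ), 3 ≤ p →
        klTowerMeasLev L M β U μ (klFlowFrameU L M β U μ n) d 1 (2 * p) ((t : ℕ) + 1) / klLevUnitF β M t p (d - 1) ≤ Ab' * (B * epsCoupling P U d) ^ (p - 1) * Qb ^ p :=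
      fun t p hp => (hlawb₁ t p hp).trans
        (mul_le_mul (mul_le_mul_of_nonneg_right hAtle (pow_nonneg (mul_nonneg hB0 (hε0 d)) _)) (pow_le_pow_left₀ hQtot₁0 hQtle p)
          (pow_nonneg hQtot₁0 _) (mul_nonneg hAb'0 (pow_nonneg (mul_nonneg hB0 (hε0 d)) _)))
    have hkj : ∀ k, k ≤ Kb → d * k ≤ j := fun k hk => le_trans (Nat.mul_le_mul_left d hk) hKbj
    exact h' G P Qh c hP hc hc6 hc₃' μ hμ U hU hU9 hU₀' hcU β hβmin hβc L M hL3 hM3 n hn1 hnN hreg hhist hfr hosc hd Kb D hKbn hD cc n' j hreg' hjn'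
      hKb1 hKbj hjK hjN B Ab Qb ι₂ X hB hAb hQb hι₂ hX Ab' ι₂' X' hAb' hι₂' hX'
      (fun (t : Fin 5) (p : ℕ) => klTowerMeasLev L M β U μ (klFlowFrameU L M β U μ n) d 1 (2 * p) ((t : ℕ) + 1)) hNb0d hcard'
      (fun t p hp => (hlawbd t p hp).trans (mul_le_mul_of_nonneg_right
        (mul_le_mul_of_nonneg_left (pow_le_pow_left₀ (mul_nonneg hB0 (hε0 d)) (mul_le_mul_of_nonneg_left (hεmono d hdj) hB0) _) hAb'0) (pow_nonneg hQb _)))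
      hZd κb αb crb ccb hκb hαb hcrb hccb (fun k hk1 hk => hDall k hk1 ((hkj k hk.le).trans hj))
      W Z σ Φ ψ τ ι₁ hW hZ hσ hΦ hψ hτ hι₁ ρk Q' Q κA Yb Y A A' ι₃ hρk hQ' hQ hκA hYb hY hA hA' hι₃ hblock hBle
      (fun k hk1 hk => (himp₁ k hk1 ((hkj k hk).trans hj)).trans
        (mul_le_mul_of_nonneg_left (mul_le_mul_of_nonneg_left (hεmono (d * k) (hkj k hk)) hB0) hι₁))
      (fun k hk1 hk => (himp₂ k hk1 ((hkj k hk).trans hj)).trans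
        (mul_le_mul_of_nonneg_left (mul_le_mul_of_nonneg_left (hεmono (d * k) (hkj k hk)) hB0) hι₂'0))
      (fun k hk2 hk => (hcell k hk2 ((hkj k hk).trans hj)).trans
        (mul_le_mul_of_nonneg_left (pow_le_pow_left₀ (mul_nonneg hB0 (hε0 _)) (mul_le_mul_of_nonneg_left (hεmono (d * k) (hkj k hk)) hB0) 2) hX'0))
      hUdoor hcdoor (hDall Kb hKb1 hKbn) Aro Qro Qtot (Atot j) hAro hQro hQtot (hAtot j) Qe (hCE j hdj hj) hcard (hsix j (le_trans (by omega : 1 ≤ d) hdj) hj)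

end Summit.HubbardSuperconductivity.HubbardSuperconductivity.Theorems.EngineV8

end
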